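import Literature.RepresentationTheory.FiniteGroups.CliffordCorrespondence
import Literature.RepresentationTheory.FiniteGroups.TaketaTheorem
import HarnessLib

/-!
# The centre of an induced irreducible character lies in the inducing subgroup (Isaacs,
# *Character Theory of Finite Groups*, Problem 5.12)

Topic `Literature/RepresentationTheory/FiniteGroups`, namespace
`Literature.RepresentationTheory.FiniteGroups` (lane `lit-hodgefound`, prover p38, row g14-#3).
Everything here is **proved**; no definition, no named fact.  `Z(χ) = {g ∈ G | |χ(g)| = χ(1)}` is
Isaacs' Def. 2.26; the tree's `Representation.centre` (`CharacterCentre`) is that set for the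
character afforded by a representation (`Representation.coe_centre`).

Source, verbatim.  I. M. Isaacs, *Character Theory of Finite Groups*, Academic Press 1976 (held
`book:isaacsnd-character-theory-finite-groups`, p. 76 = p0074 L32):

> "(5.12) Let `φ^G = χ ∈ Irr(G)` with `φ ∈ Irr(H)`. Show that `Z(χ) ⊆ H`."

## Contents and proof

* `mem_of_norm_indClassFun_eq` — for any character `φ ≠ 0` of `H ⊆ G` and `s ∈ G` with
  `|φ^G(s)| = φ^G(1)`, one has `s ∈ H`.  Proof: `φ^G(s) = |H|⁻¹ Σ_{t ∈ G, t⁻¹st ∈ H} φ(t⁻¹st)`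
  and `|φ(h)| ≤ φ(1)` (Lemma 2.15 (c)), so `|φ^G(s)| ≤ |H|⁻¹ φ(1) · #{t | t⁻¹st ∈ H}`; if `s ∉ H`
  then `t = 1` is missing from the count, so `|φ^G(s)| ≤ |H|⁻¹ φ(1) (|G| − 1) < |G : H| φ(1) =
  φ^G(1)`.  (Irreducibility of `φ` and of `φ^G` is not needed.)
* **Problem 5.12** `centre_le_of_character_eq_indClassFun` — `Z(χ) ⊆ H` for `χ = φ^G` afforded
  by a representation `ρ` of `G`, `φ` a non-zero character of `H`; and the printed form
  `centre_le_of_isIrrChar_indClassFun` (`φ ∈ Irr(H)`, `φ^G ∈ Irr(G)` afforded by `ρ`).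

## Mathlib / tree search

Mathlib: `Finset.card_erase_of_mem`, `norm_sum_le`; nothing on induced characters.  Tree, consumed
by name: `indClassFun_apply`, `extend_subtypeVal_apply`, `extend_subtypeVal_of_not_mem`
(`BrauerInduction`), `indClassFun_apply_one_eq_index_mul` (`CliffordCorrespondence`),
`norm_character_le` (`TaketaTheorem`, Lemma 2.15 (c)), `Representation.coe_centre`
(`CharacterCentre`, Def. 2.26).  `lean search 'centre.*indClassFun|indClassFun.*centre'`: nothing.

## References

* I. M. Isaacs, *Character Theory of Finite Groups*, Academic Press 1976, Problem 5.12
  (`Isaacs1976`).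
-/

noncomputable section

open scoped BigOperators

namespace Literature.RepresentationTheory.FiniteGroups

variable {G : Type} [Group G] [Fintype G] {H : Subgroup G}

/-- **"`|φ^G(s)| = φ^G(1)` forces `s ∈ H`"**: for a non-zero character `φ` of `H ⊆ G`, every `s`
with `|φ^G(s)| = φ^G(1)` lies in `H` — `|φ^G(s)| ≤ |H|⁻¹ φ(1) #{t ∈ G | t⁻¹st ∈ H}`, and `t = 1` is
missing from the count when `s ∉ H`. [cite: Isaacs1976, Problem 5.12] -/
theorem mem_of_norm_indClassFun_eq {φ : H → ℂ} (hφ : IsCharacter H φ) (h0 : φ 1 ≠ 0) {s : G}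
    (hs : (‖indClassFun H φ s‖ : ℂ) = indClassFun H φ 1) : s ∈ H := by
  classical
  by_contra hsH
  obtain ⟨V, _, _, _, ρ, hρ⟩ := hφ
  set d : ℕ := Module.finrank ℂ V with hd
  have hφ1 : φ 1 = d := by rw [← hρ, ρ.char_one]
  have hd0 : 0 < (d : ℝ) := by
    have : d ≠ 0 := fun h => h0 (by rw [hφ1, h, Nat.cast_zero])
    exact_mod_cast Nat.pos_of_ne_zero this
  -- termwise bound `|φ°(t⁻¹st)| ≤ d · [t⁻¹st ∈ H]`
  have hterm : ∀ t : G, ‖Function.extend (Subtype.val : H → G) φ 0 (t⁻¹ * s * t)‖ ≤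
      if t⁻¹ * s * t ∈ H then (d : ℝ) else 0 := by
    intro t
    by_cases ht : t⁻¹ * s * t ∈ H
    · rw [if_pos ht, show t⁻¹ * s * t = ((⟨_, ht⟩ : H) : G) from rfl, extend_subtypeVal_apply,
        ← hρ]
      exact norm_character_le ρ _
    · rw [if_neg ht, extend_subtypeVal_of_not_mem H φ ht, norm_zero]
  -- the count `#{t | t⁻¹st ∈ H} ≤ |G| - 1` (as `t = 1` fails)
  set A := (Finset.univ.filter fun t : G => t⁻¹ * s * t ∈ H) with hA
  have hAcard : (A.card : ℝ) ≤ (Fintype.card G : ℝ) - 1 := by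
    have hsub : A ⊆ Finset.univ.erase (1 : G) := by
      intro t ht
      rw [Finset.mem_erase]
      refine ⟨?_, Finset.mem_univ t⟩
      rintro rfl
      rw [hA, Finset.mem_filter] at ht
      exact hsH (by simpa using ht.2)
    have h := Finset.card_le_card hsub
    rw [Finset.card_erase_of_mem (Finset.mem_univ _), Finset.card_univ] at h
    have h1 : 1 ≤ Fintype.card G := Fintype.card_pos
    have : (A.card : ℝ) ≤ ((Fintype.card G - 1 : ℕ) : ℝ) := by exact_mod_cast h
    rwa [Nat.cast_sub h1, Nat.cast_one] at this
  -- `|φ^G(s)| ≤ |H|⁻¹ d #A`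
  have hsum : ∑ t : G, ‖Function.extend (Subtype.val : H → G) φ 0 (t⁻¹ * s * t)‖ ≤ d * A.card := by
    refine (Finset.sum_le_sum fun t _ => hterm t).trans ?_
    rw [Finset.sum_ite, Finset.sum_const_zero, add_zero, Finset.sum_const, nsmul_eq_mul, mul_comm]
  have hnorm : ‖indClassFun H φ s‖ ≤ (Nat.card H : ℝ)⁻¹ * (d * A.card) := by
    rw [indClassFun_apply, norm_mul, norm_inv, Complex.norm_natCast]
    exact mul_le_mul_of_nonneg_left ((norm_sum_le _ _).trans hsum) (inv_nonneg.mpr (Nat.cast_nonneg _))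
  -- `φ^G(1) = |G : H| d` and `|G| = |H| |G : H|`
  have h1 : (‖indClassFun H φ s‖ : ℝ) = H.index * d := by
    have h := hs
    rw [indClassFun_apply_one_eq_index_mul, hφ1] at h
    exact_mod_cast h
  have hcard : (Fintype.card G : ℝ) = (Nat.card H : ℝ) * H.index := by
    rw [← Nat.card_eq_fintype_card, ← H.card_mul_index, Nat.cast_mul]
  have hH0 : (0 : ℝ) < Nat.card H := by exact_mod_cast Nat.card_pos
  -- `|G : H| d ≤ |H|⁻¹ d (|G| - 1) < |G : H| d`
  have key : (H.index : ℝ) * d ≤ (Nat.card H : ℝ)⁻¹ * (d * ((Fintype.card G : ℝ) - 1)) :=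
    h1 ▸ hnorm.trans (mul_le_mul_of_nonneg_left (mul_le_mul_of_nonneg_left hAcard hd0.le)
      (inv_nonneg.mpr hH0.le))
  rw [hcard] at key
  have : (H.index : ℝ) * d ≤ (H.index : ℝ) * d - (Nat.card H : ℝ)⁻¹ * d := by
    calc (H.index : ℝ) * d ≤ (Nat.card H : ℝ)⁻¹ * (d * ((Nat.card H : ℝ) * H.index - 1)) := key
      _ = (H.index : ℝ) * d - (Nat.card H : ℝ)⁻¹ * d := by field_simp
  have hpos : (0 : ℝ) < (Nat.card H : ℝ)⁻¹ * d := mul_pos (inv_pos.mpr hH0) hd0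
  linarith

/-- **Problem 5.12** (Isaacs), for any non-zero character `φ` of `H`: if the representation `ρ` of
`G` affords `φ^G`, then `Z(φ^G) ⊆ H`. [cite: Isaacs1976, Problem 5.12] -/
theorem centre_le_of_character_eq_indClassFun {V : Type} [AddCommGroup V] [Module ℂ V]
    [FiniteDimensional ℂ V] (ρ : Representation ℂ G V) {φ : H → ℂ} (hφ : IsCharacter H φ)
    (h0 : φ 1 ≠ 0) (hρ : ρ.character = indClassFun H φ) : Representation.centre ρ ≤ H := by
  intro s hs
  have hs' : s ∈ (Representation.centre ρ : Set G) := hs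
  rw [Representation.coe_centre, Set.mem_setOf_eq, hρ] at hs'
  exact mem_of_norm_indClassFun_eq hφ h0 hs'

/-- **Problem 5.12** (Isaacs), as printed: let `φ^G = χ ∈ Irr(G)` with `φ ∈ Irr(H)` (`χ` afforded
by `ρ`); then `Z(χ) ⊆ H`. [cite: Isaacs1976, Problem 5.12] -/
theorem centre_le_of_isIrrChar_indClassFun {V : Type} [AddCommGroup V] [Module ℂ V]
    [FiniteDimensional ℂ V] (ρ : Representation ℂ G V) {φ : H → ℂ} (hφ : IsIrrChar H φ)
    (hρ : ρ.character = indClassFun H φ) : Representation.centre ρ ≤ H :=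
  centre_le_of_character_eq_indClassFun ρ hφ.isCharacter hφ.apply_one_ne_zero hρ

end Literature.RepresentationTheory.FiniteGroups

end
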